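import Literature.NumberTheory.Rogawski1990.CartanAlgebraDescent
import Literature.NumberTheory.Rogawski1990.CartanAlgebra
import Literature.FieldTheory.ReducedFiniteAlgebraPiFields
import Mathlib.FieldTheory.IsAlgClosed.AlgebraicClosure
import HarnessLib

/-!
# Finitely many Cartan algebras `(L[γ], τ)` up to `τ`-equivariant `L`-isomorphism (Rogawski 1990, §3.5–§3.6)

Topic `NumberTheory/Rogawski1990`; namespace `Literature.NumberTheory.Rogawski1990`. THEOREMS ONLY
(no definition, no instance, no notation, no named fact, no `sorry`); the letters of ★ `CartanIndex`.
Cell `pub/hodgecm-mathlib`, crux H413 = `stmt-HodgeConjecture-24833` (supports-only lane), line LH6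
«StCharTS», (S-𝔇) datum road, brick (B7a-S) «STABLE-TYPES-FIN» of the CARTAN-FIN (N1) road
(F0P3a-p03 lineage; dealt to F0P3a-p04 (g26), 2026-09-02).

THE MATHEMATICS. `L ⊇ F` fields with `[L : F] < ∞`, `σ` an involution of `L` fixing exactly `F`,
`2 ≠ 0`, `σ ≠ 1`; `H ∈ GL_N(L)` `σ`-hermitian. For a regular semisimple `H`-unitary `γ` (separable
characteristic polynomial, `ᵗ(σγ) H γ = H`) the Cartan algebra `L[γ]` carries the adjoint involution
`τ_γ = cartanInvolution …` (★ `CartanIndex`), `σ`-semilinear; its fixed algebra `K₀(γ) = L[γ]^{τ_γ}`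
is a reduced commutative `F`-algebra of dimension `≤ N² [L : F]`. HYPOTHESIS `hfin`: `F` has finitely
many subextensions of `F̄` of each bounded degree (true for `p`-adic fields, ★
`PadicFiniteSubextensions` ∕ `ReducedFiniteAlgebraPiFields`). THEN the `F`-isomorphism TYPE of
`K₀(γ)` ranges over a FINITE set (★ `exists_finite_representatives_of_finite_intermediateField`),
and two `γ` with `F`-isomorphic fixed algebras have `τ`-EQUIVARIANTLY `L`-isomorphic Cartan algebras
(★ (B4) `exists_algEquiv_extending_fixed_algEquiv`). Choosing one `γ₀` per realised type:

* `exists_finset_cartanAlgebra_types` — **a finite set `Γ` of regular `H`-unitary matrices such that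
  every regular `H`-unitary `γ` has `(L[γ], τ_γ) ≅ (L[γ₀], τ_{γ₀})` for some `γ₀ ∈ Γ`**
  (an `L`-algebra isomorphism `Ψ : L[γ₀] ≃ₐ[L] L[γ]` with `Ψ ∘ τ_{γ₀} = τ_γ ∘ Ψ`);
* `exists_finset_cartanAlgebra_types_unitaryGroup` — the same indexed by the unitary group
  `U(H)(L) ≤ GL_N(L)` (the hypothesis `hTypes` of ★ (B7a) `exists_finset_cartanSubgroups_of_types_of_norms`).

This is the «finitely many STABLE conjugacy classes of Cartan subgroups of `U(H)(F)`» statement of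
[Rogawski1990, §3.6 p. 31] in algebra form; (B3) ★ `SeparableCommutantConjugate` turns `Ψ` into a
`GL_N(L)`-conjugation and (B5) ★ `CartanTorusTransport` + (B6) finish inside `U(H)`. HC_CM is proved
only modulo the printed citations until rung 0 closes; this file is count-neutral algebra.

## References
* [Rogawski1990] J. D. Rogawski, *Automorphic Representations of Unitary Groups in Three Variables*,
  Ann. of Math. Stud. 123 (1990), §3.5 Prop. 3.5.2 p. 29, §3.6 p. 31.
* [PlatonovRapinchuk1994] V. Platonov, A. Rapinchuk, *Algebraic Groups and Number Theory* (1994),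
  §6.4 (finiteness of the number of conjugacy classes of maximal tori over local fields) — context.
-/

set_option autoImplicit false

noncomputable section

open Polynomial Module
open scoped Matrix MatrixGroups

namespace Literature.NumberTheory.Rogawski1990

open Literature.LinearAlgebra.Matrix
open Literature.AlgebraicGeometry.ShimuraVarieties (unitaryGroup mem_unitaryGroup_iff)

variable {F L : Type} [Field F] [Field L] [Algebra F L]

/-- The adjoint involution `τ_γ` of `L[γ]` is `σ`-SEMILINEAR: `τ(ℓ • b) = σ(ℓ) • τ(b)`
(★ `hermAdjoint_smul` under the coercion). [cite: Rogawski1990, §3.5 p. 29] -/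
theorem cartanInvolution_apply_smul (σ : L →+* L) (hσF : ∀ q : F, σ (algebraMap F L q) = algebraMap F L q)
    (hσσ : ∀ x : L, σ (σ x) = x) {N : ℕ} {H : Matrix (Fin N) (Fin N) L} (hHdet : IsUnit H.det)
    (hH : (H.map σ)ᵀ = H) {γ : Matrix (Fin N) (Fin N) L} (hreg : γ.charpoly.Separable)
    (hγ : (γ.map σ)ᵀ * H * γ = H) (ℓ : L)
    (b : ↥(Algebra.adjoin L ({γ} : Set (Matrix (Fin N) (Fin N) L)))) :
    cartanInvolution σ hσF hσσ hHdet hH hreg hγ (ℓ • b) =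
      σ ℓ • cartanInvolution σ hσF hσσ hHdet hH hreg hγ b := by
  apply Subtype.ext
  rw [coe_cartanInvolution, Subalgebra.coe_smul, Subalgebra.coe_smul, coe_cartanInvolution]
  exact hermAdjoint_smul σ H ℓ _

/-- The fixed algebra `K₀(γ) = L[γ]^{τ_γ}` is a REDUCED commutative `F`-algebra (a subalgebra of the
reduced `L[γ]`, ★ `isReduced_adjoin_singleton`). [cite: Rogawski1990, §3.5 p. 29] -/
theorem isReduced_equalizer_cartanInvolution (σ : L →+* L)
    (hσF : ∀ q : F, σ (algebraMap F L q) = algebraMap F L q)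
    (hσσ : ∀ x : L, σ (σ x) = x) {N : ℕ} {H : Matrix (Fin N) (Fin N) L} (hHdet : IsUnit H.det)
    (hH : (H.map σ)ᵀ = H) {γ : Matrix (Fin N) (Fin N) L} (hreg : γ.charpoly.Separable)
    (hγ : (γ.map σ)ᵀ * H * γ = H) :
    IsReduced ↥(AlgHom.equalizer
      (cartanInvolution σ hσF hσσ hHdet hH hreg hγ :
        ↥(Algebra.adjoin L ({γ} : Set (Matrix (Fin N) (Fin N) L))) →ₐ[F]
          ↥(Algebra.adjoin L ({γ} : Set (Matrix (Fin N) (Fin N) L))))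
      (AlgHom.id F _)) := by
  haveI := isReduced_adjoin_singleton γ hreg
  exact isReduced_of_injective (Subalgebra.val _) Subtype.val_injective

/-- The fixed algebra `K₀(γ)` is finite-dimensional over `F`, of dimension at most
`finrank F (M_N(L)) = N² [L : F]`. [cite: Rogawski1990, §3.5 p. 29] -/
theorem finrank_equalizer_cartanInvolution_le [FiniteDimensional F L] (σ : L →+* L)
    (hσF : ∀ q : F, σ (algebraMap F L q) = algebraMap F L q)
    (hσσ : ∀ x : L, σ (σ x) = x) {N : ℕ} {H : Matrix (Fin N) (Fin N) L} (hHdet : IsUnit H.det)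
    (hH : (H.map σ)ᵀ = H) {γ : Matrix (Fin N) (Fin N) L} (hreg : γ.charpoly.Separable)
    (hγ : (γ.map σ)ᵀ * H * γ = H) :
    FiniteDimensional F ↥(AlgHom.equalizer
      (cartanInvolution σ hσF hσσ hHdet hH hreg hγ :
        ↥(Algebra.adjoin L ({γ} : Set (Matrix (Fin N) (Fin N) L))) →ₐ[F]
          ↥(Algebra.adjoin L ({γ} : Set (Matrix (Fin N) (Fin N) L))))
      (AlgHom.id F _)) ∧
    finrank F ↥(AlgHom.equalizer
      (cartanInvolution σ hσF hσσ hHdet hH hreg hγ :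
        ↥(Algebra.adjoin L ({γ} : Set (Matrix (Fin N) (Fin N) L))) →ₐ[F]
          ↥(Algebra.adjoin L ({γ} : Set (Matrix (Fin N) (Fin N) L))))
      (AlgHom.id F _)) ≤ finrank F (Matrix (Fin N) (Fin N) L) := by
  haveI : FiniteDimensional F (Matrix (Fin N) (Fin N) L) := Module.Finite.trans L _
  -- the composite `K₀(γ) ⊆ L[γ] ⊆ M_N(L)`, `F`-linear and injective
  let f : ↥(AlgHom.equalizer
      (cartanInvolution σ hσF hσσ hHdet hH hreg hγ :
        ↥(Algebra.adjoin L ({γ} : Set (Matrix (Fin N) (Fin N) L))) →ₐ[F]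
          ↥(Algebra.adjoin L ({γ} : Set (Matrix (Fin N) (Fin N) L))))
      (AlgHom.id F _)) →ₗ[F] Matrix (Fin N) (Fin N) L :=
    ((Algebra.adjoin L ({γ} : Set (Matrix (Fin N) (Fin N) L))).val.toLinearMap.restrictScalars F)
      ∘ₗ (Subalgebra.val _).toLinearMap
  have hf : Function.Injective f := fun x y hxy =>
    Subtype.ext (Subtype.ext (by simpa [f] using hxy))
  exact ⟨Module.Finite.of_injective f hf, LinearMap.finrank_le_finrank_of_injective hf⟩

/-- **Finitely many Cartan algebras with involution, up to equivariant isomorphism.** Let `L ⊇ F` be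
a finite extension with an involution `σ` of `L` whose fixed field is exactly `F` (`2 ≠ 0`, `σ ≠ 1`),
`H ∈ GL_N(L)` `σ`-hermitian, and assume `F` has only finitely many subextensions of its algebraic
closure of each bounded degree (`hfin`; e.g. `F` a `p`-adic field). Then there is a FINITE set `Γ` of
regular semisimple `H`-unitary matrices such that for every regular semisimple `H`-unitary `γ` the
Cartan algebra with involution `(L[γ], τ_γ)` is isomorphic to `(L[γ₀], τ_{γ₀})` for some `γ₀ ∈ Γ`:
an `L`-algebra isomorphism `Ψ : L[γ₀] ≃ L[γ]` with `Ψ ∘ τ_{γ₀} = τ_γ ∘ Ψ`. (The `F`-isomorphism type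
of the fixed algebra `L[γ]^τ` — reduced, of dimension `≤ N²[L:F]` — ranges over a finite set by ★
`exists_finite_representatives_of_finite_intermediateField`; equal types give equivariant
`L`-isomorphisms by the descent ★ `exists_algEquiv_extending_fixed_algEquiv`.) This is the algebra
behind «finitely many stable conjugacy classes of Cartan subgroups of `U(H)`».
[cite: Rogawski1990, §3.6 p. 31] [cite: Rogawski1990, §3.5 Prop. 3.5.2 p. 29] -/
theorem exists_finset_cartanAlgebra_types [FiniteDimensional F L] (σ : L →+* L)
    (hσF : ∀ q : F, σ (algebraMap F L q) = algebraMap F L q) (hσσ : ∀ x : L, σ (σ x) = x)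
    (hFix : ∀ x : L, σ x = x → ∃ q : F, algebraMap F L q = x) (h2 : (2 : L) ≠ 0)
    (hex : ∃ ℓ : L, σ ℓ ≠ ℓ) {N : ℕ} {H : Matrix (Fin N) (Fin N) L} (hHdet : IsUnit H.det)
    (hH : (H.map σ)ᵀ = H)
    (hfin : ∀ d : ℕ, {E : IntermediateField F (AlgebraicClosure F) |
      FiniteDimensional F E ∧ Module.finrank F E ≤ d}.Finite) :
    ∃ Γ : Finset (Matrix (Fin N) (Fin N) L),
      ∀ (γ : Matrix (Fin N) (Fin N) L) (hreg : γ.charpoly.Separable) (hγ : (γ.map σ)ᵀ * H * γ = H),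
        ∃ γ₀ ∈ Γ, ∃ (hreg₀ : γ₀.charpoly.Separable) (hγ₀ : (γ₀.map σ)ᵀ * H * γ₀ = H),
          ∃ Ψ : ↥(Algebra.adjoin L ({γ₀} : Set (Matrix (Fin N) (Fin N) L))) ≃ₐ[L]
              ↥(Algebra.adjoin L ({γ} : Set (Matrix (Fin N) (Fin N) L))),
            ∀ b, Ψ (cartanInvolution σ hσF hσσ hHdet hH hreg₀ hγ₀ b) =
              cartanInvolution σ hσF hσσ hHdet hH hreg hγ (Ψ b) := by
  classical
  -- admissible elements, their Cartan algebras, involutions and fixed algebras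
  let S : Type := {γ : Matrix (Fin N) (Fin N) L // γ.charpoly.Separable ∧ (γ.map σ)ᵀ * H * γ = H}
  let B : S → Type := fun s => ↥(Algebra.adjoin L ({s.1} : Set (Matrix (Fin N) (Fin N) L)))
  let τ : ∀ s : S, B s ≃ₐ[F] B s := fun s => cartanInvolution σ hσF hσσ hHdet hH s.2.1 s.2.2
  let K : S → Type := fun s => ↥(AlgHom.equalizer (τ s : B s →ₐ[F] B s) (AlgHom.id F (B s)))
  -- the finite family of `F`-algebra types of reduced algebras of dimension `≤ N² [L:F]`
  obtain ⟨ι, hι, R, instR, instA, hR⟩ :=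
    Literature.FieldTheory.exists_finite_representatives_of_finite_intermediateField F
      (AlgebraicClosure F) hfin (finrank F (Matrix (Fin N) (Fin N) L))
  -- every admissible `γ` has a type
  have hidx : ∀ s : S, ∃ i : ι, Nonempty (K s ≃ₐ[F] R i) := by
    intro s
    haveI := isReduced_equalizer_cartanInvolution σ hσF hσσ hHdet hH s.2.1 s.2.2
    obtain ⟨hfd, hle⟩ := finrank_equalizer_cartanInvolution_le σ hσF hσσ hHdet hH s.2.1 s.2.2
    haveI := hfd
    exact hR (K s) hle
  choose idx hidx using hidx
  -- one realised element per realised type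
  let J : Type := {i : ι // i ∈ Set.range idx}
  have hJ : ∀ j : J, ∃ s : S, idx s = j.1 := fun j => j.2
  choose sel hsel using hJ
  haveI : Finite J := Subtype.finite
  let Γ : Finset (Matrix (Fin N) (Fin N) L) := (Set.finite_range fun j : J => (sel j).1).toFinset
  refine ⟨Γ, fun γ hreg hγ => ?_⟩
  let s : S := ⟨γ, hreg, hγ⟩
  let j : J := ⟨idx s, s, rfl⟩
  let s₀ : S := sel j
  have hs₀ : idx s₀ = idx s := hsel j
  have hmem : (s₀.1 : Matrix (Fin N) (Fin N) L) ∈ Γ := by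
    simp only [Γ, Set.Finite.mem_toFinset, Set.mem_range]
    exact ⟨j, rfl⟩
  -- the two fixed algebras have the same type, hence are `F`-isomorphic
  obtain ⟨e⟩ := hidx s
  have he₀ : Nonempty (K s₀ ≃ₐ[F] R (idx s)) := by rw [← hs₀]; exact hidx s₀
  obtain ⟨e₀⟩ := he₀
  let ψ₀ : K s₀ ≃ₐ[F] K s := e₀.trans e.symm
  -- descent: extend `ψ₀` to an equivariant `L`-isomorphism of the Cartan algebras
  obtain ⟨Ψ, hΨ, -⟩ := exists_algEquiv_extending_fixed_algEquiv σ (τ s₀) (τ s) hσσ hFix h2 hex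
    (cartanInvolution_apply_smul σ hσF hσσ hHdet hH s₀.2.1 s₀.2.2)
    (cartanInvolution_cartanInvolution σ hσF hσσ hHdet hH s₀.2.1 s₀.2.2)
    (cartanInvolution_apply_smul σ hσF hσσ hHdet hH hreg hγ)
    (cartanInvolution_cartanInvolution σ hσF hσσ hHdet hH hreg hγ) ψ₀
  exact ⟨s₀.1, hmem, s₀.2.1, s₀.2.2, Ψ, hΨ⟩

/-- **The same, indexed by the unitary group `U(H)(L) ≤ GL_N(L)`** (★ `ShimuraVarieties.unitaryGroup σ H`,
membership `mem_unitaryGroup_iff`): a finite set `Γ ⊆ U(H)` of regular elements whose Cartan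
algebras with involution represent those of ALL regular elements of `U(H)` — the hypothesis `hTypes`
of ★ `exists_finset_cartanSubgroups_of_types_of_norms` ((B7a) of the road), token for token.
[cite: Rogawski1990, §3.6 p. 31] [cite: Rogawski1990, §3.5 Prop. 3.5.2 p. 29] -/
theorem exists_finset_cartanAlgebra_types_unitaryGroup [FiniteDimensional F L] (σ : L →+* L)
    (hσF : ∀ q : F, σ (algebraMap F L q) = algebraMap F L q) (hσσ : ∀ x : L, σ (σ x) = x)
    (hFix : ∀ x : L, σ x = x → ∃ q : F, algebraMap F L q = x) (h2 : (2 : L) ≠ 0)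
    (hex : ∃ ℓ : L, σ ℓ ≠ ℓ) {N : ℕ} {H : Matrix (Fin N) (Fin N) L} (hHdet : IsUnit H.det)
    (hH : (H.map σ)ᵀ = H)
    (hfin : ∀ d : ℕ, {E : IntermediateField F (AlgebraicClosure F) |
      FiniteDimensional F E ∧ Module.finrank F E ≤ d}.Finite) :
    ∃ Γ : Finset ↥(unitaryGroup σ H), ∀ (γ : ↥(unitaryGroup σ H))
      (hreg : ((γ : GL (Fin N) L) : Matrix (Fin N) (Fin N) L).charpoly.Separable),
      ∃ γ₀ ∈ Γ, ∃ hreg₀ : ((γ₀ : GL (Fin N) L) : Matrix (Fin N) (Fin N) L).charpoly.Separable,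
        ∃ Ψ : ↥(Algebra.adjoin L ({((γ₀ : GL (Fin N) L) : Matrix (Fin N) (Fin N) L)} :
              Set (Matrix (Fin N) (Fin N) L))) ≃ₐ[L]
            ↥(Algebra.adjoin L ({((γ : GL (Fin N) L) : Matrix (Fin N) (Fin N) L)} :
              Set (Matrix (Fin N) (Fin N) L))),
          ∀ b, Ψ (cartanInvolution σ hσF hσσ hHdet hH hreg₀ (mem_unitaryGroup_iff.1 γ₀.2) b) =
            cartanInvolution σ hσF hσσ hHdet hH hreg (mem_unitaryGroup_iff.1 γ.2) (Ψ b) := by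
  classical
  -- regular elements of `U(H)`, their Cartan algebras, involutions and fixed algebras
  let S : Type := {γ : ↥(unitaryGroup σ H) // ((γ : GL (Fin N) L) : Matrix (Fin N) (Fin N) L).charpoly.Separable}
  let B : S → Type := fun s =>
    ↥(Algebra.adjoin L ({((s.1 : GL (Fin N) L) : Matrix (Fin N) (Fin N) L)} : Set (Matrix (Fin N) (Fin N) L)))
  let τ : ∀ s : S, B s ≃ₐ[F] B s := fun s =>
    cartanInvolution σ hσF hσσ hHdet hH s.2 (mem_unitaryGroup_iff.1 s.1.2)
  let K : S → Type := fun s => ↥(AlgHom.equalizer (τ s : B s →ₐ[F] B s) (AlgHom.id F (B s)))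
  obtain ⟨ι, hι, R, instR, instA, hR⟩ :=
    Literature.FieldTheory.exists_finite_representatives_of_finite_intermediateField F
      (AlgebraicClosure F) hfin (finrank F (Matrix (Fin N) (Fin N) L))
  have hidx : ∀ s : S, ∃ i : ι, Nonempty (K s ≃ₐ[F] R i) := by
    intro s
    haveI := isReduced_equalizer_cartanInvolution σ hσF hσσ hHdet hH s.2 (mem_unitaryGroup_iff.1 s.1.2)
    obtain ⟨hfd, hle⟩ :=
      finrank_equalizer_cartanInvolution_le σ hσF hσσ hHdet hH s.2 (mem_unitaryGroup_iff.1 s.1.2)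
    haveI := hfd
    exact hR (K s) hle
  choose idx hidx using hidx
  let J : Type := {i : ι // i ∈ Set.range idx}
  have hJ : ∀ j : J, ∃ s : S, idx s = j.1 := fun j => j.2
  choose sel hsel using hJ
  haveI : Finite J := Subtype.finite
  let Γ : Finset ↥(unitaryGroup σ H) := (Set.finite_range fun j : J => (sel j).1).toFinset
  refine ⟨Γ, fun γ hreg => ?_⟩
  let s : S := ⟨γ, hreg⟩
  let j : J := ⟨idx s, s, rfl⟩
  let s₀ : S := sel j
  have hs₀ : idx s₀ = idx s := hsel j
  have hmem : (s₀.1 : ↥(unitaryGroup σ H)) ∈ Γ := by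
    simp only [Γ, Set.Finite.mem_toFinset, Set.mem_range]
    exact ⟨j, rfl⟩
  obtain ⟨e⟩ := hidx s
  have he₀ : Nonempty (K s₀ ≃ₐ[F] R (idx s)) := by rw [← hs₀]; exact hidx s₀
  obtain ⟨e₀⟩ := he₀
  let ψ₀ : K s₀ ≃ₐ[F] K s := e₀.trans e.symm
  obtain ⟨Ψ, hΨ, -⟩ := exists_algEquiv_extending_fixed_algEquiv σ (τ s₀) (τ s) hσσ hFix h2 hex
    (cartanInvolution_apply_smul σ hσF hσσ hHdet hH s₀.2 (mem_unitaryGroup_iff.1 s₀.1.2))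
    (cartanInvolution_cartanInvolution σ hσF hσσ hHdet hH s₀.2 (mem_unitaryGroup_iff.1 s₀.1.2))
    (cartanInvolution_apply_smul σ hσF hσσ hHdet hH hreg (mem_unitaryGroup_iff.1 γ.2))
    (cartanInvolution_cartanInvolution σ hσF hσσ hHdet hH hreg (mem_unitaryGroup_iff.1 γ.2)) ψ₀
  exact ⟨s₀.1, hmem, s₀.2, Ψ, hΨ⟩

end Literature.NumberTheory.Rogawski1990

end
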